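import Literature.AlgebraicGeometry.Resolution.FormalAxisOfNearChain
import Literature.AlgebraicGeometry.Resolution.OrderAlongFormalBranch
import HarnessLib

/-!
# A Krull exponent uniform along converging coordinates ("completion once", `τ = 1` endgame)

Topic: `Literature/AlgebraicGeometry/Resolution`. In the termination proof of Cossart–Piltant 2008,
Prop. 4.4 (p. 11, case `τ = 1`: "The last statement in (2) of lemma 4.5 also implies the existence
of a regular (possibly formal) curve `Γ` such that `x_{σ(i)}` belongs to the strict transform of `Γ`
for `i ≥ i₁`: a contradiction by the same argument as above") — equivalently in the finite-depth,
completion-free rendering of Cossart–Jannsen–Saito, LNM 2270, Thm. 13.7 / Claim 13.8 used by the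
tree (`AxialUnitChainLaw.lean`: an axial chain read in FIXED coordinates `(y_N, u₁, v_N)` has length
`N < μ + K` as soon as some `g ∈ J` has `g ∉ (y_N, v_N)^μ + 𝔪^K`) — one needs the exponent `K` to be
UNIFORM in the depth `N`, the corrected coordinates `(y_N, v_N)` converging `𝔪`-adically. This file
proves that uniformity by passing to the completion ONCE (the pattern of
`FormalAxisOfNearChain.lean` / `NearChainTermination.lean`, case `τ = 2`):

* `exists_forall_not_le_pow_sup_of_not_map_le` — for a Noetherian local `R`, an ideal `𝔓` of `R^`
  with `J R^ ⊄ 𝔓^μ` and ideals `P n ≤ R` with `(P n) R^ ⊆ 𝔓 + 𝔪̂ⁿ`, there is `K` with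
  `J ⊄ (P n)^μ + 𝔪^K` for all `n ≥ K` (Krull's intersection theorem in `R^` applied once);
* `exists_forall_not_le_span_pair_pow_sup` — the case `P n = (y n, v n)`, `𝔓 = (ŷ, v̂)` the ideal of
  the `𝔪`-adic limits;
* `span_pair_adicLimit_isPrime_and_ne` — for `R` regular of dimension `3` with `(u, y₀, v₀)` a
  regular system of parameters and corrections `y_{n+1} − y_n, v_{n+1} − v_n ∈ 𝔪^{n+2}`:
  `(u, ŷ, v̂)` is a regular system of parameters of `R^` and the FORMAL AXIS `𝔓 = (ŷ, v̂)` is a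
  prime `≠ 𝔪̂` (part (b) of `exists_prime_ne_maximalIdeal_map_le_pow`, exported);
* `not_map_le_span_pair_adicLimit_pow_of_isolated` — if moreover `R` is a G-ring and the closed
  point is ISOLATED in `{ord J ≥ μ}` (no non-maximal prime `𝔮` with `J R_𝔮 ⊆ 𝔮^μ R_𝔮`), then
  `J R^ ⊄ 𝔓^μ` (`OrderAlongFormalBranch.lean`);
* `exists_uniform_krullExponent_of_isolated` — **the uniform exponent**: under these hypotheses
  there is `K` with `J ⊄ (y_n, v_n)^μ + 𝔪^K` for every `n ≥ K`.

## Sources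

* V. Cossart, O. Piltant, J. Algebra 320 (2008) 1051–1082, proof of Prop. 4.4, p. 11 (case `τ = 1`).
  [CossartPiltant2008]
* V. Cossart, U. Jannsen, S. Saito, LNM 2270 (2020), Thm. 13.7, Claim 13.8 (the endgame served).
  [CossartJannsenSaito2020]
* H. Matsumura, *Commutative Ring Theory* (1986), Thm. 8.10 (Krull), §32 (G-rings). [Matsumura1987]
-/

noncomputable section

open IsLocalRing

namespace Literature.AlgebraicGeometry.Resolution

universe u

/-! ## The uniform exponent from one application of Krull's theorem in the completion -/

section Uniform

variable {R : Type u} [CommRing R] [IsLocalRing R] [IsNoetherianRing R]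


/-- **A Krull exponent uniform along a sequence of ideals converging in the completion.** Let `R`
be a Noetherian local ring, `J ≤ R`, `𝔓` an ideal of `R^` with `J R^ ⊄ 𝔓^μ`, and `P n ≤ R` ideals
with `(P n) R^ ⊆ 𝔓 + 𝔪̂ⁿ`. Then there is `K` such that `J ⊄ (P n)^μ + 𝔪^K` for every `n ≥ K`: by
Krull's intersection theorem `J R^ ⊄ 𝔓^μ + 𝔪̂^K` for some `K`, and for `n ≥ K`,
`((P n)^μ + 𝔪^K) R^ ⊆ (𝔓 + 𝔪̂^K)^μ + 𝔪̂^K ⊆ 𝔓^μ + 𝔪̂^K`. [cite: Matsumura1987, Thm. 8.10] -/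
theorem exists_forall_not_le_pow_sup_of_not_map_le (J : Ideal R)
    (𝔓 : Ideal (AdicCompletion (maximalIdeal R) R)) (μ : ℕ)
    (hJ : ¬ J.map (algebraMap R (AdicCompletion (maximalIdeal R) R)) ≤ 𝔓 ^ μ)
    (P : ℕ → Ideal R)
    (hP : ∀ n, (P n).map (algebraMap R (AdicCompletion (maximalIdeal R) R)) ≤
      𝔓 ⊔ maximalIdeal (AdicCompletion (maximalIdeal R) R) ^ n) :
    ∃ K, ∀ n, K ≤ n → ¬ J ≤ P n ^ μ ⊔ maximalIdeal R ^ K := by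
  set ι := algebraMap R (AdicCompletion (maximalIdeal R) R) with hι
  haveI : IsNoetherianRing (AdicCompletion (maximalIdeal R) R) :=
    isNoetherianRing_adicCompletion_maximalIdeal R
  have hmmap : maximalIdeal (AdicCompletion (maximalIdeal R) R) = (maximalIdeal R).map ι :=
    AdicCompletion.maximalIdeal_eq_map
  -- Krull in `R^`: some level `K` already separates `J R^` from `𝔓^μ`
  have hK :
      ∃ K, ¬ J.map ι ≤ 𝔓 ^ μ ⊔ maximalIdeal (AdicCompletion (maximalIdeal R) R) ^ K := by
    by_contra h
    push Not at h
    exact hJ (le_of_forall_le_sup_pow h)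
  obtain ⟨K, hK⟩ := hK
  refine ⟨K, fun n hn hle => hK ?_⟩
  calc J.map ι ≤ (P n ^ μ ⊔ maximalIdeal R ^ K).map ι := Ideal.map_mono hle
    _ = (P n).map ι ^ μ ⊔ maximalIdeal (AdicCompletion (maximalIdeal R) R) ^ K := by
        rw [Ideal.map_sup, Ideal.map_pow, Ideal.map_pow, ← hmmap]
    _ ≤ (𝔓 ⊔ maximalIdeal (AdicCompletion (maximalIdeal R) R) ^ K) ^ μ ⊔
          maximalIdeal (AdicCompletion (maximalIdeal R) R) ^ K := by
        refine sup_le_sup_right (Ideal.pow_right_mono ((hP n).trans ?_) μ) _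
        exact sup_le_sup_left (Ideal.pow_le_pow_right hn) _
    _ ≤ 𝔓 ^ μ ⊔ maximalIdeal (AdicCompletion (maximalIdeal R) R) ^ K :=
        sup_le (sup_pow_le_pow_sup _ _ μ) le_sup_right

/-- **The case of two converging coordinates.** For sequences `y, v` in the Noetherian local ring
`R` with `y (n+1) − y n, v (n+1) − v n ∈ 𝔪ⁿ` and `𝔪`-adic limits `ŷ, v̂ ∈ R^` (`adicLimit`): if
`J R^ ⊄ (ŷ, v̂)^μ` then there is `K` with `J ⊄ (y n, v n)^μ + 𝔪^K` for all `n ≥ K`.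
[cite: Matsumura1987, Thm. 8.10] -/
theorem exists_forall_not_le_span_pair_pow_sup (J : Ideal R) (μ : ℕ) (y v : ℕ → R)
    (hy : ∀ n, y (n + 1) - y n ∈ maximalIdeal R ^ n)
    (hv : ∀ n, v (n + 1) - v n ∈ maximalIdeal R ^ n)
    (hJ : ¬ J.map (algebraMap R (AdicCompletion (maximalIdeal R) R)) ≤
      Ideal.span {adicLimit y hy, adicLimit v hv} ^ μ) :
    ∃ K, ∀ n, K ≤ n → ¬ J ≤ Ideal.span {y n, v n} ^ μ ⊔ maximalIdeal R ^ K := by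
  set ι := algebraMap R (AdicCompletion (maximalIdeal R) R) with hι
  set 𝔓 : Ideal (AdicCompletion (maximalIdeal R) R) :=
    Ideal.span {adicLimit y hy, adicLimit v hv} with h𝔓
  refine exists_forall_not_le_pow_sup_of_not_map_le J 𝔓 μ hJ (fun n => Ideal.span {y n, v n})
    fun n => ?_
  -- `ι (z n) = ẑ − (ẑ − ι (z n)) ∈ 𝔓 + 𝔪̂ⁿ`
  have hzmem : ∀ (z : ℕ → R) (hz : ∀ n, z (n + 1) - z n ∈ maximalIdeal R ^ n),
      adicLimit z hz ∈ 𝔓 →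
      ι (z n) ∈ 𝔓 ⊔ maximalIdeal (AdicCompletion (maximalIdeal R) R) ^ n := by
    intro z hz hP
    have hsub := adicLimit_sub_of_mem_pow z hz n
    have : ι (z n) = adicLimit z hz - (adicLimit z hz - ι (z n)) := by ring
    rw [this]
    exact Ideal.sub_mem _ (Ideal.mem_sup_left hP) (Ideal.mem_sup_right hsub)
  rw [Ideal.map_span, Ideal.span_le]
  rintro _ ⟨a, ha, rfl⟩
  simp only [Set.mem_insert_iff, Set.mem_singleton_iff] at ha
  rcases ha with rfl | rfl
  · exact hzmem y hy (Ideal.subset_span (by simp))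
  · exact hzmem v hv (Ideal.subset_span (by simp))

end Uniform

/-! ## The formal axis `(ŷ, v̂)` of converging regular parameters -/

section Axis

variable {R : Type u} [CommRing R] [IsRegularLocalRing R]


/-- **The formal axis of converging regular parameters.** Let `R` be a regular local ring of
dimension `3` with regular system of parameters `(u, y₀, v₀)`, and `y, v : ℕ → R` corrections with
`y (n+1) − y n, v (n+1) − v n ∈ 𝔪^{n+2}`, `y 0 = y₀`, `v 0 = v₀`. Then for the `𝔪`-adic limits
`ŷ, v̂ ∈ R^`: `(u, ŷ, v̂)` generates `𝔪̂`, and `𝔓 = (ŷ, v̂)` is a prime ideal of `R^` different from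
`𝔪̂` (part (b) of the proof of `exists_prime_ne_maximalIdeal_map_le_pow`,
`FormalAxisOfNearChain.lean`).
[cite: CossartPiltant2008, Prop. 4.4 (proof, p. 11)] -/
theorem span_pair_adicLimit_isPrime_and_ne (u y₀ v₀ : R)
    (hgen : Ideal.span {u, y₀, v₀} = maximalIdeal R) (hdim : ringKrullDim R = 3)
    (y v : ℕ → R) (hy : ∀ n, y (n + 1) - y n ∈ maximalIdeal R ^ (n + 2))
    (hv : ∀ n, v (n + 1) - v n ∈ maximalIdeal R ^ (n + 2)) (h0y : y 0 = y₀) (h0v : v 0 = v₀)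
    (hy' : ∀ n, y (n + 1) - y n ∈ maximalIdeal R ^ n)
    (hv' : ∀ n, v (n + 1) - v n ∈ maximalIdeal R ^ n) :
    Ideal.span {algebraMap R (AdicCompletion (maximalIdeal R) R) u, adicLimit y hy',
        adicLimit v hv'} =
        maximalIdeal (AdicCompletion (maximalIdeal R) R) ∧
      (Ideal.span {adicLimit y hy', adicLimit v hv'}).IsPrime ∧
      Ideal.span {adicLimit y hy', adicLimit v hv'} ≠
        maximalIdeal (AdicCompletion (maximalIdeal R) R) := by
  classical
  set yl : (AdicCompletion (maximalIdeal R) R) := adicLimit y hy' with hyl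
  set vl : (AdicCompletion (maximalIdeal R) R) := adicLimit v hv' with hvl
  set ι := algebraMap R (AdicCompletion (maximalIdeal R) R) with hι
  set 𝔓 : Ideal (AdicCompletion (maximalIdeal R) R) := Ideal.span {yl, vl} with h𝔓
  haveI : IsRegularLocalRing (AdicCompletion (maximalIdeal R) R) :=
    isRegularLocalRing_adicCompletion R
  have hdim' : ringKrullDim (AdicCompletion (maximalIdeal R) R) = 3 := by
    rw [ringKrullDim_adicCompletion, hdim]
  have hmmap : maximalIdeal (AdicCompletion (maximalIdeal R) R) = (maximalIdeal R).map ι :=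
    AdicCompletion.maximalIdeal_eq_map
  have hy₀m : y₀ ∈ maximalIdeal R := hgen ▸ Ideal.subset_span (by simp)
  have hv₀m : v₀ ∈ maximalIdeal R := hgen ▸ Ideal.subset_span (by simp)
  have hum : u ∈ maximalIdeal R := hgen ▸ Ideal.subset_span (by simp)
  -- `z 1 ∈ 𝔪`, `z 2 − z₀ ∈ 𝔪²`
  have hz1 : ∀ (z : ℕ → R), (∀ n, z (n + 1) - z n ∈ maximalIdeal R ^ (n + 2)) →
      ∀ w ∈ maximalIdeal R, z 0 = w → z 1 ∈ maximalIdeal R ∧ z 2 - w ∈ maximalIdeal R ^ 2 := by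
    intro z hz w hw h0
    have h01 : z 1 - z 0 ∈ maximalIdeal R ^ 2 := hz 0
    have h12 : z 2 - z 1 ∈ maximalIdeal R ^ 3 := hz 1
    constructor
    · have : z 1 = (z 1 - z 0) + w := by rw [h0]; ring
      rw [this]
      exact Ideal.add_mem _ (Ideal.pow_le_self (by norm_num) h01) hw
    · have : z 2 - w = (z 2 - z 1) + (z 1 - z 0) := by rw [h0]; ring
      rw [this]
      exact Ideal.add_mem _ (Ideal.pow_le_pow_right (by norm_num) h12) h01
  obtain ⟨hy1, hy2⟩ := hz1 y hy y₀ hy₀m h0y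
  obtain ⟨hv1, hv2⟩ := hz1 v hv v₀ hv₀m h0v
  have hlim_mem : ∀ (z : ℕ → R) (hz : ∀ n, z (n + 1) - z n ∈ maximalIdeal R ^ n),
      z 1 ∈ maximalIdeal R →
      adicLimit z hz ∈ maximalIdeal (AdicCompletion (maximalIdeal R) R) := by
    intro z hz h1
    have hsub := adicLimit_sub_of_mem_pow z hz 1
    rw [pow_one] at hsub
    have : adicLimit z hz = (adicLimit z hz - ι (z 1)) + ι (z 1) := by ring
    rw [this]
    refine Ideal.add_mem _ hsub ?_
    rw [hmmap]; exact Ideal.mem_map_of_mem _ h1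
  have hιw : ∀ (z : ℕ → R) (hz : ∀ n, z (n + 1) - z n ∈ maximalIdeal R ^ n) (w : R),
      z 2 - w ∈ maximalIdeal R ^ 2 →
      ι w ∈ Ideal.span {adicLimit z hz} ⊔
        maximalIdeal (AdicCompletion (maximalIdeal R) R) ^ 2 := by
    intro z hz w h2
    have hsub := adicLimit_sub_of_mem_pow z hz 2
    have : ι w = adicLimit z hz - (adicLimit z hz - ι (z 2)) - ι (z 2 - w) := by
      rw [map_sub]; ring
    rw [this]
    refine Ideal.sub_mem _ (Ideal.sub_mem _ (Ideal.mem_sup_left (Ideal.subset_span rfl))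
      (Ideal.mem_sup_right hsub)) (Ideal.mem_sup_right ?_)
    rw [hmmap, ← Ideal.map_pow]
    exact Ideal.mem_map_of_mem _ h2
  set x : Fin 3 → (AdicCompletion (maximalIdeal R) R) := ![ι u, yl, vl] with hx
  have hrange : Set.range x = {ι u, yl, vl} := by
    rw [hx]; ext a
    simp [Matrix.range_cons, Matrix.range_empty]
    tauto
  have hxspan : Ideal.span (Set.range x) = maximalIdeal (AdicCompletion (maximalIdeal R) R) := by
    rw [hrange]
    apply le_antisymm
    · rw [Ideal.span_le]
      intro a ha
      simp only [Set.mem_insert_iff, Set.mem_singleton_iff] at ha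
      rcases ha with rfl | rfl | rfl
      · rw [hmmap]; exact Ideal.mem_map_of_mem _ hum
      · exact hlim_mem y hy' hy1
      · exact hlim_mem v hv' hv1
    · -- Nakayama: `𝔪̂ ≤ (u, yl, vl) + 𝔪̂²`
      refine Submodule.le_of_le_smul_of_le_jacobson_bot
        (maximalIdeal (AdicCompletion (maximalIdeal R) R)).fg_of_isNoetherianRing
        (IsLocalRing.maximalIdeal_le_jacobson _) ?_
      rw [Ideal.smul_eq_mul, ← sq]
      have hmspan : Ideal.span (ι '' {u, y₀, v₀}) = (maximalIdeal R).map ι := by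
        rw [← Ideal.map_span, hgen]
      conv_lhs => rw [hmmap, ← hmspan]
      rw [Ideal.span_le]
      rintro _ ⟨a, ha, rfl⟩
      simp only [Set.mem_insert_iff, Set.mem_singleton_iff] at ha
      have hle₂ : Ideal.span {yl} ⊔ maximalIdeal (AdicCompletion (maximalIdeal R) R) ^ 2 ≤
          Ideal.span {ι u, yl, vl} ⊔ maximalIdeal (AdicCompletion (maximalIdeal R) R) ^ 2 :=
        sup_le_sup_right (Ideal.span_mono (Set.singleton_subset_iff.mpr (by simp))) _
      have hle₃ : Ideal.span {vl} ⊔ maximalIdeal (AdicCompletion (maximalIdeal R) R) ^ 2 ≤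
          Ideal.span {ι u, yl, vl} ⊔ maximalIdeal (AdicCompletion (maximalIdeal R) R) ^ 2 :=
        sup_le_sup_right (Ideal.span_mono (Set.singleton_subset_iff.mpr (by simp))) _
      rcases ha with rfl | rfl | rfl
      · exact Ideal.mem_sup_left (Ideal.subset_span (by simp))
      · exact hle₂ (hιw y hy' _ hy2)
      · exact hle₃ (hιw v hv' _ hv2)
  have hfr : (maximalIdeal (AdicCompletion (maximalIdeal R) R)).spanFinrank = 3 := by
    have := (isRegularLocalRing_iff (AdicCompletion (maximalIdeal R) R)).mp inferInstance
    rw [hdim'] at this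
    exact_mod_cast this
  -- `𝔓 = (x₁, x₂)` is prime
  have h𝔓eq : 𝔓 = Ideal.span (x '' ↑({1, 2} : Finset (Fin 3))) := by
    rw [h𝔓]; congr 1
    ext a
    simp [hx]
    tauto
  have hprime : 𝔓.IsPrime := by
    rw [h𝔓eq]; exact isPrime_span_image hfr x hxspan {1, 2}
  -- `𝔓 ≠ 𝔪̂`: `𝔪̂` needs three generators
  have hne : 𝔓 ≠ maximalIdeal (AdicCompletion (maximalIdeal R) R) := by
    intro heq
    have h1 := Submodule.spanFinrank_span_le_ncard_of_finite
      (R := (AdicCompletion (maximalIdeal R) R))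
      (Set.toFinite ({yl, vl} : Set (AdicCompletion (maximalIdeal R) R)))
    have h2 : ({yl, vl} : Set (AdicCompletion (maximalIdeal R) R)).ncard ≤ 2 := by
      rw [← Finset.coe_pair, Set.ncard_coe_finset]; exact Finset.card_le_two
    have h3 :
        (Ideal.span {yl, vl} : Ideal (AdicCompletion (maximalIdeal R) R)).spanFinrank = 3 := by
      change 𝔓.spanFinrank = 3
      rw [heq]; exact hfr
    change (Ideal.span {yl, vl}).spanFinrank ≤ _ at h1
    omega
  exact ⟨hrange ▸ hxspan, hprime, hne⟩

/-- **Isolation excludes the formal axis.** In the situation of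
`span_pair_adicLimit_isPrime_and_ne`,
if `R` is a G-ring and the closed point is ISOLATED in `{ord J ≥ μ}` — no non-maximal prime `𝔮`
of `R` has `J R_𝔮 ⊆ 𝔮^μ R_𝔮` — then `J R^ ⊄ (ŷ, v̂)^μ`: otherwise the algebraic branch
`𝔮 = (ŷ, v̂) ∩ R` below the formal axis has order `≥ μ` (`OrderAlongFormalBranch.lean`) and is not
maximal. [cite: CossartPiltant2008, Prop. 4.4 (proof, p. 11)] -/
theorem not_map_le_span_pair_adicLimit_pow_of_isolated (hG : IsGRing R) (u y₀ v₀ : R)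
    (hgen : Ideal.span {u, y₀, v₀} = maximalIdeal R) (hdim : ringKrullDim R = 3)
    (y v : ℕ → R) (hy : ∀ n, y (n + 1) - y n ∈ maximalIdeal R ^ (n + 2))
    (hv : ∀ n, v (n + 1) - v n ∈ maximalIdeal R ^ (n + 2)) (h0y : y 0 = y₀) (h0v : v 0 = v₀)
    (hy' : ∀ n, y (n + 1) - y n ∈ maximalIdeal R ^ n)
    (hv' : ∀ n, v (n + 1) - v n ∈ maximalIdeal R ^ n) (J : Ideal R) (μ : ℕ)
    (hisol : ∀ (𝔮 : Ideal R) [𝔮.IsPrime], 𝔮 ≠ maximalIdeal R →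
      ¬ J.map (algebraMap R (Localization.AtPrime 𝔮)) ≤ maximalIdeal (Localization.AtPrime 𝔮) ^ μ) :
    ¬ J.map (algebraMap R (AdicCompletion (maximalIdeal R) R)) ≤
      Ideal.span {adicLimit y hy', adicLimit v hv'} ^ μ := by
  intro hle
  obtain ⟨-, hprime, hne⟩ := span_pair_adicLimit_isPrime_and_ne u y₀ v₀ hgen hdim y v hy hv h0y h0v
    hy' hv'
  set 𝔓 : Ideal (AdicCompletion (maximalIdeal R) R) :=
    Ideal.span {adicLimit y hy', adicLimit v hv'} with h𝔓
  haveI := hprime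
  have hbranch := map_le_pow_maximalIdeal_localization_under hG J μ 𝔓 hle
  refine hisol (𝔓.under R) ?_ hbranch
  intro h𝔮
  apply hne
  refine ((maximalIdeal.isMaximal _).eq_of_le hprime.ne_top ?_).symm
  rw [AdicCompletion.maximalIdeal_eq_map, Ideal.map_le_iff_le_comap]
  intro r hr
  change r ∈ 𝔓.under R
  rw [h𝔮]
  exact hr

/-- **The uniform Krull exponent of the `τ = 1` endgame.** Let `R` be a regular local G-ring of
dimension `3` (e.g. the local ring of an excellent regular threefold at a closed point),
`(u, y₀, v₀)`
a regular system of parameters, `y, v : ℕ → R` corrections with `y (n+1) − y n, v (n+1) − v n ∈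
𝔪^{n+2}`, `y 0 = y₀`, `v 0 = v₀` (the depth-`n` coordinates of the chain), and `J ≤ R`, `μ : ℕ`
such that the closed point is isolated in `{ord J ≥ μ}`. Then there is ONE exponent `K` with
`J ⊄ (y n, v n)^μ + 𝔪^K` for every `n ≥ K` — the hypothesis of `axialChain_length_lt`
(`AxialUnitChainLaw.lean`) uniformly in the depth.
[cite: CossartPiltant2008, Prop. 4.4 (proof, p. 11)]
[cite: CossartJannsenSaito2020, Thm. 13.7 (proof, Claim 13.8)] -/
theorem exists_uniform_krullExponent_of_isolated (hG : IsGRing R) (u y₀ v₀ : R)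
    (hgen : Ideal.span {u, y₀, v₀} = maximalIdeal R) (hdim : ringKrullDim R = 3)
    (y v : ℕ → R) (hy : ∀ n, y (n + 1) - y n ∈ maximalIdeal R ^ (n + 2))
    (hv : ∀ n, v (n + 1) - v n ∈ maximalIdeal R ^ (n + 2)) (h0y : y 0 = y₀) (h0v : v 0 = v₀)
    (J : Ideal R) (μ : ℕ)
    (hisol : ∀ (𝔮 : Ideal R) [𝔮.IsPrime], 𝔮 ≠ maximalIdeal R →
      ¬ J.map (algebraMap R (Localization.AtPrime 𝔮)) ≤ maximalIdeal (Localization.AtPrime 𝔮) ^ μ) :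
    ∃ K, ∀ n, K ≤ n → ¬ J ≤ Ideal.span {y n, v n} ^ μ ⊔ maximalIdeal R ^ K := by
  have hy' : ∀ n, y (n + 1) - y n ∈ maximalIdeal R ^ n := fun n =>
    Ideal.pow_le_pow_right (by omega) (hy n)
  have hv' : ∀ n, v (n + 1) - v n ∈ maximalIdeal R ^ n := fun n =>
    Ideal.pow_le_pow_right (by omega) (hv n)
  exact exists_forall_not_le_span_pair_pow_sup J μ y v hy' hv'
    (not_map_le_span_pair_adicLimit_pow_of_isolated hG u y₀ v₀ hgen hdim y v hy hv h0y h0v hy' hv'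
      J μ hisol)

end Axis

end Literature.AlgebraicGeometry.Resolution

end
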